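import Mathlib
import HarnessLib
import Summits.HubbardSuperconductivity.HubbardSuperconductivity.Theorems.KLProgrammeLatticeSoftBubble
import Summits.HubbardSuperconductivity.HubbardSuperconductivity.Theorems.KLProgrammeForwardBubbleSoftSharpTC

/-!
# Route `KLProgramme` — ENGINE item stmt-HubbardSuperconductivity-20437 `KLRegimeEngineV17F2`, class-#5 STEP (X).3 pinned pair «88b» /
# located-risk #14, factor (γ)-TR: the forward / SOFT slice bubble ON THE LATTICE with the sharp zero-sound term, the SPLIT Matsubara count and the
# PATH transfer constant `K′ = (3ℓ′ + 512M_f′)/Λ²` (cell gate-hubbard-kl, seat hubbard-kl-k3c2-p2 g22, technique «thermal-bar induction n ≤ nScales β + 1 with EngineBoundsAtV4S sums»)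

Text-faithful twins (suffix `TC`) of `klfl_lattice_forward_bubble_norm_le_of_lipschitz` and `klfl_lattice_soft_bubble_norm_le` on `klfs_planar_bubble_norm_le_of_lipschitzTC`
and `klfp_prop_cutWeight_lipschitz_path`: zero-sound coefficient `(64/π)·M_F`; transfer term `(64/π)·…·D + (48/π)·…·D·((π/β)/Λ)`; cut-partner constant
`(3ℓ′ + 512M_f′)/Λ²` (no support hypothesis on `f′` is needed any more); lattice (Riemann) term unchanged.
Pure analysis on the tree's objects; nothing about the model is asserted; nothing asserts (X).3, (c), K3 or superconductivity.
References: BGM 2006 §2.4–2.5 [cite: BenfattoGiulianiMastropietro2006]; FST 1998 App. B [cite: FeldmanSalmhoferTrubowitz1998].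
-/


noncomputable section

namespace Summit.HubbardSuperconductivity.HubbardSuperconductivity.Theorems.KLRegimeSplit

set_option linter.dupNamespace false -- summit = problem name (single-conjunct summit), D-0017

open Real Set Filter MeasureTheory Complex Literature.MathematicalPhysics.QuantumLattice Literature.Probability.LatticeModels
open Literature.MathematicalPhysics.QuantumLattice.BandSectorCounting
open Summit.HubbardSuperconductivity.HubbardSuperconductivity.Theorems.PerturbedFermiCurve
open Summit.HubbardSuperconductivity.HubbardSuperconductivity.Theorems.KLProgrammeLegKernels
open scoped NNReal

/-! ## §1 The forward slice bubble on the model carrier, second line by its joint Lipschitz constant -/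

section Lattice

variable {a' b' : ℝ} (B : BandBounds a' b') {δ : (Fin 2 → ℝ) → ℝ} (hδ1 : ContDiff ℝ 1 δ) {κ₀ κ₁ : ℝ}
  (hδ : ∀ k : Fin 2 → ℝ, (∀ i, |k i| ≤ π) → |δ k| ≤ κ₀)
  (hκ : ∀ k : Fin 2 → ℝ, (∀ i, |k i| ≤ π) → ‖fderiv ℝ δ k‖ ≤ κ₁) (hκ₁ : κ₁ < B.Dtmin)

include B hδ1 hδ hκ hκ₁ in
/-- **THE FORWARD SLICE BUBBLE ON `MatsubaraIdx M × TorusSite 2 L`, second line by its joint Lipschitz constant `K′` and sup `M′`** (no support hypothesis on `f'`; the zero-transfer product `F = f·f'` carries `M_F`, `ℓ`).  Data: the frame (p4's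
hypotheses + radial `κ₂`, margin window); a doubly `2π`-periodic continuous weight `a` (`‖a‖ ≤ A₀`, `L_a`-Lipschitz, sup metric); the periodic frame band
`eb` (continuous, `L_e`-Lipschitz, `= klfb_band δ μ` on the closed square) and shifted band `eb'` (periodic, continuous, `L_e'`-Lipschitz,
`|eb' − e| ≤ δ_max` on the open square); the zone margin `zm > 0`; shell weights `f, f'` as in `klfb_planar_bubble_norm_le` plus `L_f ≤ ℓ_f/Λ_n²`.  Then, with
`A₁ := L_a + A₀·(2/zm)`, `K := L_a·(2M_f/Λ_n)(2M_f'/Λ_n) + A₀·((9ℓ_f+4M_f)L_e/Λ_n²)(2M_f'/Λ_n) + A₀(2M_f/Λ_n)((9ℓ'+4M_f')L_e'/Λ_n²)`: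
`‖β⁻¹•Σ_i L⁻²•Σ_k a(p_k)Φ_f(ω_i, eb(p_k))Φ_{f'}(ω_i+q₀, eb'(p_k))‖ ≤ (2π)⁻²·(2π·[ZS + thermal + shift bracket of `klfb_planar_bubble_norm_le` at (A₀, A₁)]) + 32Λ_n·K/L`. -/
theorem klfl_lattice_forward_bubble_norm_le_of_lipschitzTC
    {κ₂ : ℝ} (hκ₂ : 0 ≤ κ₂)
    (hD2 : ∀ θ s t : ℝ, s ∈ Icc 0 (π / ‖dir θ‖) → t ∈ Icc 0 (π / ‖dir θ‖) →
      |fderiv ℝ δ (s • dir θ) (dir θ) - fderiv ℝ δ (t • dir θ) (dir θ)| ≤ κ₂ * |s - t|)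
    {a : ℝ × ℝ → ℂ} (ha : Continuous a) (ha1 : ∀ x y, a (x + 2 * π, y) = a (x, y)) (ha2 : ∀ x y, a (x, y + 2 * π) = a (x, y))
    {A₀ La : ℝ} (hA0 : ∀ p, ‖a p‖ ≤ A₀) (hLa : ∀ p q, ‖a p - a q‖ ≤ La * dist p q)
    {eb : ℝ × ℝ → ℝ} (hebc : Continuous eb) (heb1 : ∀ x y, eb (x + 2 * π, y) = eb (x, y)) (heb2 : ∀ x y, eb (x, y + 2 * π) = eb (x, y))
    {Le : ℝ} (hLe : ∀ p q, |eb p - eb q| ≤ Le * dist p q) {μ : ℝ} (heb : ∀ p ∈ Icc (-π) π ×ˢ Icc (-π) π, eb p = klfb_band δ μ p)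
    {eb' : ℝ × ℝ → ℝ} (heb'c : Continuous eb') (heb'1 : ∀ x y, eb' (x + 2 * π, y) = eb' (x, y)) (heb'2 : ∀ x y, eb' (x, y + 2 * π) = eb' (x, y))
    {Le' : ℝ} (hLe' : ∀ p q, |eb' p - eb' q| ≤ Le' * dist p q) {δmax : ℝ} (hδ0 : 0 ≤ δmax)
    (he'δ : ∀ p : ℝ × ℝ, |p.1| < π → |p.2| < π → |eb' p - klfb_band δ μ p| ≤ δmax)
    {zm : ℝ} (hzm : 0 < zm) {n : ℕ}
    (hzone : ∀ p ∈ Icc (-π) π ×ˢ Icc (-π) π, |eb p| < 4 * klScale klE0 n → |p.1| ≤ π - 2 * zm ∧ |p.2| ≤ π - 2 * zm)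
    {f f' : ℝ → ℂ} {Lf Mf ℓf LF MF ℓ : ℝ}
    (hlip : ∀ s s', ‖f s - f s'‖ ≤ Lf * |s - s'|) (hbd : ∀ s, ‖f s‖ ≤ Mf) (hLf : Lf ≤ ℓf / klScale klE0 n ^ 2)
    (hin : ∀ s, s ≤ (klScale klE0 n / 2) ^ 2 → f s = 0) (hout : ∀ s, (4 * klScale klE0 n) ^ 2 ≤ s → f s = 0)
    {K' M' : ℝ} (hK' : 0 ≤ K') (hΨlip : ∀ k₀ e k₀' e', ‖klfb_prop f' k₀ e - klfb_prop f' k₀' e'‖ ≤ K' * (|k₀ - k₀'| + |e - e'|))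
    (hM' : ∀ k₀ e, ‖klfb_prop f' k₀ e‖ ≤ M')
    (hMF : 0 ≤ MF) (hFlip : ∀ s s', ‖f s * f' s - f s' * f' s'‖ ≤ LF * |s - s'|) (hFbd : ∀ s, ‖f s * f' s‖ ≤ MF)
    (hLF : LF ≤ ℓ / klScale klE0 n ^ 2)
    (hlo : a' < μ - 4 * klScale klE0 n - κ₀) (hhi : μ + 4 * klScale klE0 n + κ₀ < b')
    (q₀ : ℝ) {β : ℝ} (hβ : klBetaMin ≤ β) (hn : n ≤ nScales β + 1) {M : ℕ}
    (hM : β * (4 * klScale klE0 n) / (2 * Real.pi) + 1 ≤ M) (L : ℕ) [NeZero L] :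
    ‖β⁻¹ • ∑ i : MatsubaraIdx M, ((L ^ 2 : ℕ) : ℝ)⁻¹ • ∑ k : TorusSite 2 L,
        a (latticeMomentum L k 0, latticeMomentum L k 1) *
          klfb_prop f (matsubaraFreq β M i) (eb (latticeMomentum L k 0, latticeMomentum L k 1)) *
            klfb_prop f' (matsubaraFreq β M i + q₀) (eb' (latticeMomentum L k 0, latticeMomentum L k 1))‖ ≤
      ((2 * π) ^ 2)⁻¹ *
          (2 * Real.pi *
            (64 / Real.pi * MF *
                (Real.pi * Real.sqrt 2 / (B.Dtmin - κ₁) * (La + A₀ * (2 / zm)) / (B.Dtmin - κ₁) +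
                  A₀ * (1 / (B.Dtmin - κ₁) ^ 2 + Real.pi * Real.sqrt 2 * (2 + κ₂) / (B.Dtmin - κ₁) ^ 3)) * klScale klE0 n +
              393216 / Real.pi * (ℓ + 8 * MF) * (A₀ * (Real.pi * Real.sqrt 2 / (B.Dtmin - κ₁))) * ((Real.pi / β) / klScale klE0 n) +
              (64 / Real.pi * Mf * (A₀ * (Real.pi * Real.sqrt 2 / (B.Dtmin - κ₁))) * (K' * klScale klE0 n) * (|q₀| + δmax) +
                48 / Real.pi * Mf * (A₀ * (Real.pi * Real.sqrt 2 / (B.Dtmin - κ₁))) * (K' * klScale klE0 n) * (|q₀| + δmax) * ((Real.pi / β) / klScale klE0 n)))) +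
        32 * klScale klE0 n *
            (La * (2 * Mf / klScale klE0 n) * M' +
              A₀ * ((9 * ℓf + 4 * Mf) / klScale klE0 n ^ 2 * Le) * M' +
              A₀ * (2 * Mf / klScale klE0 n) * (K' * Le')) / L := by
  have hΛ := klth_klScale_pos n
  have hr₁ : 0 < klScale klE0 n / 2 := by positivity
  have hr : 0 < 4 * klScale klE0 n := by positivity
  have hA0' : 0 ≤ A₀ := (norm_nonneg _).trans (hA0 0)
  have hLa0 : 0 ≤ La := by
    have h := hLa (1, 0) (0, 0)
    have hd : (0 : ℝ) < dist ((1 : ℝ), (0 : ℝ)) ((0 : ℝ), (0 : ℝ)) := by rw [Prod.dist_eq]; simp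
    exact nonneg_of_mul_nonneg_left ((norm_nonneg _).trans h) hd
  have hLe0 : 0 ≤ Le := by
    have h := hLe (1, 0) (0, 0)
    have hd : (0 : ℝ) < dist ((1 : ℝ), (0 : ℝ)) ((0 : ℝ), (0 : ℝ)) := by rw [Prod.dist_eq]; simp
    exact nonneg_of_mul_nonneg_left ((abs_nonneg _).trans h) hd
  have hLe'0 : 0 ≤ Le' := by
    have h := hLe' (1, 0) (0, 0)
    have hd : (0 : ℝ) < dist ((1 : ℝ), (0 : ℝ)) ((0 : ℝ), (0 : ℝ)) := by rw [Prod.dist_eq]; simp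
    exact nonneg_of_mul_nonneg_left ((abs_nonneg _).trans h) hd
  have hMf : 0 ≤ Mf := (norm_nonneg _).trans (hbd 0)
  have hM'0 : 0 ≤ M' := (norm_nonneg _).trans (hM' 0 0)
  have hℓf : 0 ≤ 9 * ℓf + 4 * Mf := by
    have hLf0 : 0 ≤ Lf := by have := hlip 0 1; norm_num at this; linarith [norm_nonneg (f 0 - f 1)]
    have : 0 ≤ ℓf := by
      have h := hLf0.trans hLf; rwa [le_div_iff₀ (by positivity), zero_mul] at h
    positivity
  -- the planar weight `A = a·ψ`
  set A : ℝ × ℝ → ℂ := fun p => a p * (klfl_squareCut zm p : ℂ) with hAdef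
  have hψbd : ∀ p, ‖(klfl_squareCut zm p : ℂ)‖ ≤ 1 := fun p => by
    rw [Complex.norm_real, Real.norm_of_nonneg (klfl_squareCut_mem zm p).1]; exact (klfl_squareCut_mem zm p).2
  have hAc : Continuous A := ha.mul (Complex.continuous_ofReal.comp (klfl_continuous_squareCut zm))
  have hAsupp : ∀ p : ℝ × ℝ, A p ≠ 0 → |p.1| < π ∧ |p.2| < π := by
    intro p hp
    have hψ : klfl_squareCut zm p ≠ 0 := fun h0 => hp (by simp only [hAdef, h0, Complex.ofReal_zero, mul_zero])
    obtain ⟨h1, h2⟩ := klfl_abs_lt_of_squareCut_ne_zero hzm hψ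
    exact ⟨by linarith, by linarith⟩
  have hAbd : ∀ p, ‖A p‖ ≤ A₀ := fun p => by
    simp only [hAdef]; rw [norm_mul]
    calc ‖a p‖ * ‖(klfl_squareCut zm p : ℂ)‖ ≤ A₀ * 1 := mul_le_mul (hA0 p) (hψbd p) (norm_nonneg _) hA0'
      _ = A₀ := mul_one _
  have hArad : ∀ θ t t' : ℝ, 0 ≤ t → 0 ≤ t' →
      ‖A (t * Real.cos θ, t * Real.sin θ) - A (t' * Real.cos θ, t' * Real.sin θ)‖ ≤ (La + A₀ * (2 / zm)) * |t - t'| := by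
    intro θ t t' _ _
    set x := (t * Real.cos θ, t * Real.sin θ) with hx
    set y := (t' * Real.cos θ, t' * Real.sin θ) with hy
    have hd : dist x y ≤ |t - t'| := klfl_dist_ray_le θ t t'
    have hsplit : A x - A y = (a x - a y) * (klfl_squareCut zm x : ℂ) + a y * ((klfl_squareCut zm x : ℂ) - (klfl_squareCut zm y : ℂ)) := by
      simp only [hAdef]; ring
    rw [hsplit]
    have h1 : ‖(a x - a y) * (klfl_squareCut zm x : ℂ)‖ ≤ La * |t - t'| * 1 := by
      rw [norm_mul]
      exact mul_le_mul ((hLa x y).trans (mul_le_mul_of_nonneg_left hd hLa0)) (hψbd x) (norm_nonneg _) (by positivity)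
    have h2 : ‖a y * ((klfl_squareCut zm x : ℂ) - (klfl_squareCut zm y : ℂ))‖ ≤ A₀ * (2 / zm * |t - t'|) := by
      rw [norm_mul, ← Complex.ofReal_sub, Complex.norm_real, Real.norm_eq_abs]
      exact mul_le_mul (hA0 y) ((klfl_squareCut_lipschitz hzm x y).trans (mul_le_mul_of_nonneg_left hd (by positivity)))
        (abs_nonneg _) hA0'
    calc _ ≤ ‖(a x - a y) * (klfl_squareCut zm x : ℂ)‖ + ‖a y * ((klfl_squareCut zm x : ℂ) - (klfl_squareCut zm y : ℂ))‖ := norm_add_le _ _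
      _ ≤ La * |t - t'| * 1 + A₀ * (2 / zm * |t - t'|) := add_le_add h1 h2
      _ = (La + A₀ * (2 / zm)) * |t - t'| := by ring
  -- the planar bound
  have hB := klfs_planar_bubble_norm_le_of_lipschitzTC B hδ1 hδ hκ hκ₁ hAc hAsupp hAbd hArad hκ₂ hD2 hlip hbd hin hout hK' hΨlip
    hMF hFlip hFbd hLF heb'c hδ0 he'δ hlo hhi q₀ hβ hn hM
  -- the periodic family and its properties
  set F : MatsubaraIdx M → ℝ × ℝ → ℂ := fun i p =>
    a p * klfb_prop f (matsubaraFreq β M i) (eb p) * klfb_prop f' (matsubaraFreq β M i + q₀) (eb' p) with hFdef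
  have hΦc : ∀ k₀, Continuous fun e => klfb_prop f k₀ e := fun k₀ => klfb_continuous_prop_snd hlip hbd hin hout hr₁ hr k₀
  have hΨc : ∀ k₀, Continuous fun e => klfb_prop f' k₀ e := fun k₀ => klfs_continuous_snd_of_lipschitz hΨlip k₀
  have hFc : ∀ i, Continuous (F i) := fun i => (ha.mul ((hΦc _).comp hebc)).mul ((hΨc _).comp heb'c)
  have hF1 : ∀ i x y, F i (x + 2 * π, y) = F i (x, y) := fun i x y => by simp only [hFdef, ha1, heb1, heb'1]
  have hF2 : ∀ i x y, F i (x, y + 2 * π) = F i (x, y) := fun i x y => by simp only [hFdef, ha2, heb2, heb'2]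
  set K : ℝ := La * (2 * Mf / klScale klE0 n) * M' +
    A₀ * ((9 * ℓf + 4 * Mf) / klScale klE0 n ^ 2 * Le) * M' +
    A₀ * (2 * Mf / klScale klE0 n) * (K' * Le') with hKdef
  have hK0 : 0 ≤ K := by rw [hKdef]; positivity
  have hFlip' : ∀ i (p q : ℝ × ℝ), ‖F i p - F i q‖ ≤ (K.toNNReal : ℝ) * dist p q := by
    intro i p q
    rw [Real.coe_toNNReal _ hK0]
    have hv : ∀ p q : ℝ × ℝ, ‖klfb_prop f (matsubaraFreq β M i) (eb p) - klfb_prop f (matsubaraFreq β M i) (eb q)‖ ≤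
        (9 * ℓf + 4 * Mf) / klScale klE0 n ^ 2 * Le * dist p q :=
      fun p q => (klfl_prop_lipschitz_snd hlip hbd hLf hin hout (matsubaraFreq β M i) (eb p) (eb q)).trans (by
        rw [mul_assoc]; exact mul_le_mul_of_nonneg_left (hLe p q) (by positivity))
    have hw : ∀ p q : ℝ × ℝ, ‖klfb_prop f' (matsubaraFreq β M i + q₀) (eb' p) - klfb_prop f' (matsubaraFreq β M i + q₀) (eb' q)‖ ≤
        K' * Le' * dist p q := by
      intro p q
      have h := hΨlip (matsubaraFreq β M i + q₀) (eb' p) (matsubaraFreq β M i + q₀) (eb' q)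
      rw [sub_self, abs_zero, zero_add] at h
      refine h.trans ?_
      rw [mul_assoc]; exact mul_le_mul_of_nonneg_left (hLe' p q) hK'
    exact klfl_lipschitz_triple (u := a) (v := fun p => klfb_prop f (matsubaraFreq β M i) (eb p))
      (w := fun p => klfb_prop f' (matsubaraFreq β M i + q₀) (eb' p))
      hA0 (fun p => klfl_prop_norm_le hbd hin (matsubaraFreq β M i) (eb p))
      (fun p => hM' (matsubaraFreq β M i + q₀) (eb' p)) hLa hv hw p q
  have hFh : ∀ i, ∀ p ∈ Icc (-π) π ×ˢ Icc (-π) π, F i p = klfb_integrand δ μ A f f' eb' (matsubaraFreq β M i) q₀ p :=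
    fun i p hp => klfl_integrand_eq_on_square hzm heb hzone hout (matsubaraFreq β M i) q₀ hp
  have hh0 : ∀ i, ∀ p ∉ Icc (-π) π ×ˢ Icc (-π) π, klfb_integrand δ μ A f f' eb' (matsubaraFreq β M i) q₀ p = 0 :=
    fun i p hp => klfl_integrand_eq_zero_off_square hzm (matsubaraFreq β M i) q₀ hp
  have hzero : ∀ i, 4 * klScale klE0 n ≤ |matsubaraFreq β M i| → ∀ p, F i p = 0 := by
    intro i hi p
    simp only [hFdef]
    rw [klfl_prop_eq_zero_of_le_abs_fst hout hi, mul_zero, zero_mul]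
  have h := klfl_matsubara_latticeAverage_norm_le_scale (F := F) (h := fun i => klfb_integrand δ μ A f f' eb' (matsubaraFreq β M i) q₀)
    hβ hn hFc hF1 hF2 hFlip' hFh hh0 hzero hB L
  rw [Real.coe_toNNReal _ hK0] at h
  exact h


end Lattice

/-! ## §2 The soft partner on the lattice -/

section Soft

variable {a' b' : ℝ} (B : BandBounds a' b') {δ : (Fin 2 → ℝ) → ℝ} (hδ1 : ContDiff ℝ 1 δ) {κ₀ κ₁ : ℝ}
  (hδ : ∀ k : Fin 2 → ℝ, (∀ i, |k i| ≤ π) → |δ k| ≤ κ₀)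
  (hκ : ∀ k : Fin 2 → ℝ, (∀ i, |k i| ≤ π) → ‖fderiv ℝ δ k‖ ≤ κ₁) (hκ₁ : κ₁ < B.Dtmin)


include B hδ1 hδ hκ hκ₁ in
/-- **THE FORWARD SLICE BUBBLE ON THE MODEL CARRIER WITH A SOFT PARTNER** (second weight `f'` Lipschitz `≤ ℓ'/Λ_n²`, bounded `M_f'`, zero for
`s ≥ (4Λ_n)²`, NO inner support radius — e.g. `d_n = 1 − χ₂(s/Λ_n²)`), below resolution: `|q₀| ≤ Λ_n/8`, `|ẽ' − ẽ| ≤ δ_max ≤ Λ_n/8` everywhere.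
Conclusion = `klfl_lattice_forward_bubble_norm_le_of_lipschitz` at `K′ = (65ℓ' + 17408M_f'/3)/Λ_n²`, `M′ = 16M_f'/Λ_n`. -/
theorem klfl_lattice_soft_bubble_norm_leTC
    {κ₂ : ℝ} (hκ₂ : 0 ≤ κ₂)
    (hD2 : ∀ θ s t : ℝ, s ∈ Icc 0 (π / ‖dir θ‖) → t ∈ Icc 0 (π / ‖dir θ‖) →
      |fderiv ℝ δ (s • dir θ) (dir θ) - fderiv ℝ δ (t • dir θ) (dir θ)| ≤ κ₂ * |s - t|)
    {a : ℝ × ℝ → ℂ} (ha : Continuous a) (ha1 : ∀ x y, a (x + 2 * π, y) = a (x, y)) (ha2 : ∀ x y, a (x, y + 2 * π) = a (x, y))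
    {A₀ La : ℝ} (hA0 : ∀ p, ‖a p‖ ≤ A₀) (hLa : ∀ p q, ‖a p - a q‖ ≤ La * dist p q)
    {eb : ℝ × ℝ → ℝ} (hebc : Continuous eb) (heb1 : ∀ x y, eb (x + 2 * π, y) = eb (x, y)) (heb2 : ∀ x y, eb (x, y + 2 * π) = eb (x, y))
    {Le : ℝ} (hLe : ∀ p q, |eb p - eb q| ≤ Le * dist p q) {μ : ℝ} (heb : ∀ p ∈ Icc (-π) π ×ˢ Icc (-π) π, eb p = klfb_band δ μ p)
    {eb' : ℝ × ℝ → ℝ} (heb'c : Continuous eb') (heb'1 : ∀ x y, eb' (x + 2 * π, y) = eb' (x, y)) (heb'2 : ∀ x y, eb' (x, y + 2 * π) = eb' (x, y))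
    {Le' : ℝ} (hLe' : ∀ p q, |eb' p - eb' q| ≤ Le' * dist p q) {δmax : ℝ} (hδ0 : 0 ≤ δmax) {n : ℕ}
    (hδmax : δmax ≤ klScale klE0 n / 8) (hshift : ∀ p : ℝ × ℝ, |eb' p - eb p| ≤ δmax)
    {zm : ℝ} (hzm : 0 < zm)
    (hzone : ∀ p ∈ Icc (-π) π ×ˢ Icc (-π) π, |eb p| < 4 * klScale klE0 n → |p.1| ≤ π - 2 * zm ∧ |p.2| ≤ π - 2 * zm)
    {f f' : ℝ → ℂ} {Lf Mf ℓf Lf' Mf' ℓ' LF MF ℓ : ℝ}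
    (hlip : ∀ s s', ‖f s - f s'‖ ≤ Lf * |s - s'|) (hbd : ∀ s, ‖f s‖ ≤ Mf) (hLf : Lf ≤ ℓf / klScale klE0 n ^ 2)
    (hin : ∀ s, s ≤ (klScale klE0 n / 2) ^ 2 → f s = 0) (hout : ∀ s, (4 * klScale klE0 n) ^ 2 ≤ s → f s = 0)
    (hlip' : ∀ s s', ‖f' s - f' s'‖ ≤ Lf' * |s - s'|) (hbd' : ∀ s, ‖f' s‖ ≤ Mf') (hLf' : Lf' ≤ ℓ' / klScale klE0 n ^ 2)
    (hMF : 0 ≤ MF) (hFlip : ∀ s s', ‖f s * f' s - f s' * f' s'‖ ≤ LF * |s - s'|) (hFbd : ∀ s, ‖f s * f' s‖ ≤ MF)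
    (hLF : LF ≤ ℓ / klScale klE0 n ^ 2)
    (hlo : a' < μ - 4 * klScale klE0 n - κ₀) (hhi : μ + 4 * klScale klE0 n + κ₀ < b')
    {q₀ : ℝ} (hq₀ : |q₀| ≤ klScale klE0 n / 8) {β : ℝ} (hβ : klBetaMin ≤ β) (hn : n ≤ nScales β + 1) {M : ℕ}
    (hM : β * (4 * klScale klE0 n) / (2 * Real.pi) + 1 ≤ M) (L : ℕ) [NeZero L] :
    ‖β⁻¹ • ∑ i : MatsubaraIdx M, ((L ^ 2 : ℕ) : ℝ)⁻¹ • ∑ k : TorusSite 2 L,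
        a (latticeMomentum L k 0, latticeMomentum L k 1) *
          klfb_prop f (matsubaraFreq β M i) (eb (latticeMomentum L k 0, latticeMomentum L k 1)) *
            klfb_prop f' (matsubaraFreq β M i + q₀) (eb' (latticeMomentum L k 0, latticeMomentum L k 1))‖ ≤
      ((2 * π) ^ 2)⁻¹ *
          (2 * Real.pi *
            (64 / Real.pi * MF *
                (Real.pi * Real.sqrt 2 / (B.Dtmin - κ₁) * (La + A₀ * (2 / zm)) / (B.Dtmin - κ₁) +
                  A₀ * (1 / (B.Dtmin - κ₁) ^ 2 + Real.pi * Real.sqrt 2 * (2 + κ₂) / (B.Dtmin - κ₁) ^ 3)) * klScale klE0 n +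
              393216 / Real.pi * (ℓ + 8 * MF) * (A₀ * (Real.pi * Real.sqrt 2 / (B.Dtmin - κ₁))) * ((Real.pi / β) / klScale klE0 n) +
              (64 / Real.pi * Mf * (A₀ * (Real.pi * Real.sqrt 2 / (B.Dtmin - κ₁))) *
                ((3 * ℓ' + 512 * Mf') / klScale klE0 n ^ 2 * klScale klE0 n) * (|q₀| + δmax) +
                48 / Real.pi * Mf * (A₀ * (Real.pi * Real.sqrt 2 / (B.Dtmin - κ₁))) *
                ((3 * ℓ' + 512 * Mf') / klScale klE0 n ^ 2 * klScale klE0 n) * (|q₀| + δmax) * ((Real.pi / β) / klScale klE0 n)))) +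
        32 * klScale klE0 n *
            (La * (2 * Mf / klScale klE0 n) * (16 * Mf' / klScale klE0 n) +
              A₀ * ((9 * ℓf + 4 * Mf) / klScale klE0 n ^ 2 * Le) * (16 * Mf' / klScale klE0 n) +
              A₀ * (2 * Mf / klScale klE0 n) * ((3 * ℓ' + 512 * Mf') / klScale klE0 n ^ 2 * Le')) / L := by
  have hΛ := klth_klScale_pos n
  have hMf' : 0 ≤ Mf' := (norm_nonneg _).trans (hbd' 0)
  have hLf'0 : 0 ≤ Lf' := by have := hlip' 0 1; norm_num at this; linarith [norm_nonneg (f' 0 - f' 1)]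
  have hℓ' : 0 ≤ ℓ' := by have h := hLf'0.trans hLf'; rwa [le_div_iff₀ (by positivity), zero_mul] at h
  -- the shifted band against the frame band on the open square
  have he'δ : ∀ p : ℝ × ℝ, |p.1| < π → |p.2| < π → |eb' p - klfb_band δ μ p| ≤ δmax := by
    intro p h1 h2
    rw [← heb p ⟨⟨(abs_lt.mp h1).1.le, (abs_lt.mp h1).2.le⟩, ⟨(abs_lt.mp h2).1.le, (abs_lt.mp h2).2.le⟩⟩]
    exact hshift p
  -- cut the second weight
  have hcut : ∀ (i : MatsubaraIdx M) (k : TorusSite 2 L),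
      a (latticeMomentum L k 0, latticeMomentum L k 1) *
          klfb_prop f (matsubaraFreq β M i) (eb (latticeMomentum L k 0, latticeMomentum L k 1)) *
            klfb_prop f' (matsubaraFreq β M i + q₀) (eb' (latticeMomentum L k 0, latticeMomentum L k 1)) =
        a (latticeMomentum L k 0, latticeMomentum L k 1) *
          klfb_prop f (matsubaraFreq β M i) (eb (latticeMomentum L k 0, latticeMomentum L k 1)) *
            klfb_prop (fun s => f' s * (klfp_cut (klScale klE0 n) s : ℂ)) (matsubaraFreq β M i + q₀)
              (eb' (latticeMomentum L k 0, latticeMomentum L k 1)) :=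
    fun i k => klfl_summand_cut_eq hin hq₀ ((hshift _).trans hδmax)
  simp_rw [hcut]
  have hK' : 0 ≤ (3 * ℓ' + 512 * Mf') / klScale klE0 n ^ 2 := by positivity
  have hFlip'' : ∀ s s', ‖f s * (f' s * (klfp_cut (klScale klE0 n) s : ℂ)) - f s' * (f' s' * (klfp_cut (klScale klE0 n) s' : ℂ))‖ ≤
      LF * |s - s'| := fun s s' => by rw [klfp_mul_cutWeight_eq hin s, klfp_mul_cutWeight_eq hin s']; exact hFlip s s'
  have hFbd'' : ∀ s, ‖f s * (f' s * (klfp_cut (klScale klE0 n) s : ℂ))‖ ≤ MF := fun s => by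
    rw [klfp_mul_cutWeight_eq hin s]; exact hFbd s
  exact klfl_lattice_forward_bubble_norm_le_of_lipschitzTC B hδ1 hδ hκ hκ₁ hκ₂ hD2 ha ha1 ha2 hA0 hLa hebc heb1 heb2 hLe heb heb'c heb'1 heb'2
    hLe' hδ0 he'δ hzm hzone hlip hbd hLf hin hout hK' (klfp_prop_cutWeight_lipschitz_path hlip' hbd' hLf')
    (klfl_prop_cutWeight_norm_le hbd') hMF hFlip'' hFbd'' hLF hlo hhi q₀ hβ hn hM L


end Soft

end Summit.HubbardSuperconductivity.HubbardSuperconductivity.Theorems.KLRegimeSplit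

end
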